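import Summits.CriticalPhenomena.PercolationContinuityZ3.Theorems.PercNearOneGluingNoHeavyLowerTailQuantitativeS5PeelIdentity
import Summits.CriticalPhenomena.PercolationContinuityZ3.Theorems.PercNearOneGluingNoHeavyLowerTailQuantitativeS5DegenerateVanishing
import HarnessLib

/-!
# The exact GEN PEELING IDENTITY: the master form `Sur_o(A)` is an (S5) margin with the top relay as second observer, plus the
# top relay's rank gain, plus one conditional covariance — and (GEN) is (S5) with a blind second observer

Support file (`--supports stmt-CriticalPhenomena-4575`), prover seat `prim-rate-mine-2` (lane prim-rate, constants-miner (c), BENCH row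
M2-R42; `run/shared/lean/prim/prim-rate/prim-rate-mine-2/PROOFS.md` §P42).  No definitions, no named facts, no sorries; standard axioms.

The tree's (GEN) `Sur_o(A) ≥ 0` (`AGloc.gen_firstRank_of_surplusTransfer`; it is what (AG-loc) and the crux `AdditiveGluing` consume) peels the
rank-maximal relay `k` of `A` with van den Berg–Häggström–Kahn's one-cluster inequality and then applies (S5) to `T = A ∖ k` with SECOND OBSERVER `k`.
Keeping every discarded quantity gives an exact identity, valid for EVERY functional `F` and all weights `< 1` (no monotonicity, no compatibility,
any observer `o`): with `D_k = {k ↮ T}`, `F̂_k(C) = F({k} ∪ ⋃ C)`,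

* `CSH.surplus_peel_top` — **`μ(D_k)·surplus w A r F o = μ(D_k)·s5dMargin w T r [] o k F + covD w k T F̂_k o + rankGain w A r F k · μ(D_k ∩ {o ↔ k})`**
  (Lemma P `CSH.surplus_erase_add`, `CSH.covD_clusterFun_eq`, Lemma κ `CSH.rankGain_top_eq`, `CSH.s5dMargin_nil`).
  For monotone `F ≥ 0` and a compatible rank the three terms are `≥ 0` ((S5), vdBHK Thm 1.3, Lemma κ), so the ZERO SET of (GEN) is the
  intersection of three known loci (rows M2-R41 / M2-R29, the rank-gain locus, and the strictness locus of vdBHK Thm 1.3 — file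
  `…QuantitativeBHKCovDLocus`), assembled in `…QuantitativeGenZeroSet`.
* `CSH.s5dMargin_nil_eq_surplus_of_isolated` — **(GEN) is (S5) with a BLIND second observer**: if no pair of positive weight meets `v`, `v ∉ T`,
  `v ≠ o`, then `s5dMargin w T r [] o v F = surplus w T r F o`; and `CSH.s5dMargin_singleton_decoy_eq_of_isolated` — with a blind second
  observer the LAST DECOY becomes the second observer: `s5dMargin w T r [d] o v F = s5dMargin w T r [] o d F`.  (So every (S5) theorem of the
  lane specialises to (GEN), and the one-decoy level (S5D)₁ with a blind observer is (S5).)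
[cite: KozmaNitzan2024, Conj. 4 (p. 32), Lemma 2 (p. 6)] [cite: VandenbergHaggstromKahn2005, Thm. 1.3 (p. 6)]
-/

noncomputable section

namespace Summit.CriticalPhenomena.PercolationContinuityZ3.Theorems

open MeasureTheory Set Literature.Probability.LatticeModels Literature.Probability.Percolation
open scoped Classical
open KNPreFKG

namespace CSH

variable {n : ℕ}

/-- **The exact GEN peeling identity at the rank-maximal relay.**  Weights `< 1`; `k ∈ A` rank-maximal for a rank `r` injective on `A`,
`T = A ∖ k`, `D_k = {k ↮ T}`; any observer `o`, ANY functional `F`: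
`μ(D_k)·Sur_o(A) = μ(D_k)·s5dMargin w T r [] o k F + covD w k T F̂_k o + γ_k·μ(D_k ∩ {o ↔ k})`.
[cite: KozmaNitzan2024, Conj. 4 (p. 32), Lemma 2 (p. 6)] [cite: VandenbergHaggstromKahn2005, Thm. 1.3 (p. 6)] -/
theorem surplus_peel_top (w : Sym2 (Fin n) → unitInterval) (hw : ∀ e, w e < 1) (A : Finset (Fin n)) (r : Fin n → ℕ)
    (F : Set (Fin n) → ℝ) (o k : Fin n) (hkA : k ∈ A) (hr : Set.InjOn r ↑A) (hkmax : ∀ a ∈ A, r a ≤ r k) :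
    (prodBernoulli w).real {ω : BondConfig (Fin n) | ∀ a ∈ (↑(A.erase k) : Set (Fin n)), ¬ (openGraph ω).Reachable k a} *
        surplus w A r F o =
      (prodBernoulli w).real {ω : BondConfig (Fin n) | ∀ a ∈ (↑(A.erase k) : Set (Fin n)), ¬ (openGraph ω).Reachable k a} *
          s5dMargin w (A.erase k) r [] o k F +
        covD w k (↑(A.erase k) : Set (Fin n)) (fun C => F {a | a = k ∨ ∃ e ∈ C, a ∈ e}) o +
        rankGain w A r F k *
          (prodBernoulli w).real ({ω : BondConfig (Fin n) | ∀ a ∈ (↑(A.erase k) : Set (Fin n)), ¬ (openGraph ω).Reachable k a} ∩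
            openConn o k) := by
  set μ := prodBernoulli w with hμ
  set T : Finset (Fin n) := A.erase k with hT
  have hTA : ∀ a ∈ T, a ∈ A := fun a ha => Finset.mem_of_mem_erase ha
  have hkT : k ∉ T := Finset.notMem_erase k A
  have hlt : ∀ a ∈ T, r a < r k := by
    intro a ha
    rcases (hkmax a (hTA a ha)).lt_or_eq with h | h
    · exact h
    · exact absurd (hr (hTA a ha) hkA h) (Finset.ne_of_mem_erase ha)
  set Dk : Set (BondConfig (Fin n)) := {ω : BondConfig (Fin n) | ∀ a ∈ (↑T : Set (Fin n)), ¬ (openGraph ω).Reachable k a} with hDk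
  have hempty_Dk : (∅ : BondConfig (Fin n)) ∈ Dk := by
    intro a ha h
    rw [HullPort.reachable_empty_iff] at h
    exact hkT (h ▸ (Finset.mem_coe.1 ha))
  have hDkpos : 0 < μ.real Dk := prodBernoulli_real_pos_of_empty_mem w hw hempty_Dk
  set mk : ℝ := ∫ ω, F (openCluster ω k) ∂μ with hmk
  set κ : ℝ := mk * μ.real Dk - ∫ ω in Dk, F (openCluster ω k) ∂μ with hκ
  -- Lemma P at `u = o`
  have hpeel := surplus_erase_add w A r F hkA hlt o
  -- the top-relay term through `covD`
  have hcov := covD_clusterFun_eq w T F k o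
  -- Lemma κ
  have hγ : rankGain w A r F k = surplus w T r F k - κ := by
    rw [rankGain_top_eq w A r F k hkA hr hkmax]
  -- the (S5) margin with second observer `k`
  have hs5 := s5dMargin_nil w T r o k F
  have hsymm : (openConn o k : Set (BondConfig (Fin n))) = openConn k o := openConn_symm o k
  rw [hsymm] at hs5 ⊢
  have hs5' : μ.real Dk * s5dMargin w T r [] o k F =
      μ.real Dk * surplus w T r F o - μ.real (Dk ∩ openConn k o) * surplus w T r F k := by
    rw [hs5, mul_sub, ← mul_assoc, mul_div_cancel₀ _ (ne_of_gt hDkpos)]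
  simp only [← hμ, ← hDk, ← hmk] at hpeel hcov hs5' ⊢
  rw [hs5', hγ, hpeel, mul_add, hcov]
  ring

/-- **(GEN) is (S5) with a blind second observer.**  Weights vanishing on every pair at `v` (the second observer sees nothing), `v ∉ T`, `v ≠ o`:
`s5dMargin w T r [] o v F = surplus w T r F o` (the observers' constant `μ(o ↔ v | v ↮ T)` vanishes).  Hence every (S5) statement of the lane,
read at a blind second observer, is a statement about the master form (GEN). [cite: KozmaNitzan2024, Conj. 4 (p. 32)] -/
theorem s5dMargin_nil_eq_surplus_of_isolated (w : Sym2 (Fin n) → unitInterval) (T : Finset (Fin n)) (r : Fin n → ℕ)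
    (F : Set (Fin n) → ℝ) (o v : Fin n) (hov : o ≠ v) (hv : ∀ z : Fin n, (w s(v, z) : ℝ) = 0) :
    s5dMargin w T r [] o v F = surplus w T r F o := by
  set E : Set (Sym2 (Fin n)) := {e | ∀ z ∈ e, z ≠ v} with hE
  have hE0 : ∀ f, f ∉ E → (w f : ℝ) = 0 := by
    intro f hf
    simp only [hE, mem_setOf_eq, not_forall, not_not, exists_prop] at hf
    obtain ⟨z, hzf, rfl⟩ := hf
    have : f = s(z, Sym2.Mem.other hzf) := (Sym2.other_spec hzf).symm
    rw [this]
    exact hv _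
  have hreach : ¬ (openGraph E).Reachable o v := by
    intro h
    obtain ⟨W⟩ := h
    obtain ⟨p, hp⟩ := W.reverse.toPath |> fun p => (⟨p, trivial⟩ : ∃ _p : (openGraph E).Path v o, True)
    have hne : v ≠ o := fun h => hov h.symm
    cases hp' : p.1 with
    | nil => exact hne rfl
    | cons hadj _ =>
      rw [openGraph_adj] at hadj
      exact hadj.1 v (Sym2.mem_mk_left _ _) rfl
  have hnull : (prodBernoulli w).real (openConn o v) = 0 := by
    rw [measureReal_def, measure_openConn_eq_zero_of_not_reachable w E hE0 o v hreach, ENNReal.toReal_zero]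
  have hnum : (prodBernoulli w).real ({ω : BondConfig (Fin n) | ∀ a ∈ (↑T : Set (Fin n)), ¬ (openGraph ω).Reachable v a} ∩ openConn o v) = 0 :=
    le_antisymm (hnull ▸ measureReal_mono inter_subset_right) measureReal_nonneg
  rw [s5dMargin_nil, hnum, zero_div, zero_mul, sub_zero]

/-- **With a blind second observer the decoy becomes the second observer.**  Weights vanishing on every pair at `v`, `v ∉ T`, `v ≠ o`,
`v ≠ d`: `s5dMargin w T r [d] o v F = s5dMargin w T r [] o d F` — the one-decoy level (S5D)₁ at a blind observer is (S5) with second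
observer `d` (the decoy constant `μ(d ↔ · | d ↮ T)` at `o` IS the observers' constant of the pair `(o, d)`; Lemma R `CSH.cshMarg_cons`).
[cite: KozmaNitzan2024, Conj. 4 (p. 32)] -/
theorem s5dMargin_singleton_decoy_eq_of_isolated (w : Sym2 (Fin n) → unitInterval) (T : Finset (Fin n)) (r : Fin n → ℕ)
    (F : Set (Fin n) → ℝ) (o v d : Fin n) (hov : o ≠ v) (hv : ∀ z : Fin n, (w s(v, z) : ℝ) = 0) :
    s5dMargin w T r [d] o v F = s5dMargin w T r [] o d F := by
  set E : Set (Sym2 (Fin n)) := {e | ∀ z ∈ e, z ≠ v} with hE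
  have hE0 : ∀ f, f ∉ E → (w f : ℝ) = 0 := by
    intro f hf
    simp only [hE, mem_setOf_eq, not_forall, not_not, exists_prop] at hf
    obtain ⟨z, hzf, rfl⟩ := hf
    have : f = s(z, Sym2.Mem.other hzf) := (Sym2.other_spec hzf).symm
    rw [this]
    exact hv _
  have hreach : ¬ (openGraph E).Reachable o v := by
    intro h
    obtain ⟨W⟩ := h
    obtain ⟨p, hp⟩ := W.reverse.toPath |> fun p => (⟨p, trivial⟩ : ∃ _p : (openGraph E).Path v o, True)
    have hne : v ≠ o := fun h => hov h.symm
    cases hp' : p.1 with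
    | nil => exact hne rfl
    | cons hadj _ =>
      rw [openGraph_adj] at hadj
      exact hadj.1 v (Sym2.mem_mk_left _ _) rfl
  have hnull : (prodBernoulli w).real (openConn o v) = 0 := by
    rw [measureReal_def, measure_openConn_eq_zero_of_not_reachable w E hE0 o v hreach, ENNReal.toReal_zero]
  have hp0 : obsConst w o v ((↑T : Set (Fin n)) ∪ {d' | d' ∈ [d]}) = 0 := by
    have hnum : (prodBernoulli w).real
        ({ω : BondConfig (Fin n) | ∀ a ∈ ((↑T : Set (Fin n)) ∪ {d' | d' ∈ [d]}), ¬ (openGraph ω).Reachable v a} ∩ openConn o v) = 0 :=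
      le_antisymm (hnull ▸ measureReal_mono inter_subset_right) measureReal_nonneg
    rw [obsConst, hnum, zero_div]
  have hsymm : (openConn o d : Set (BondConfig (Fin n))) = openConn d o := openConn_symm o d
  rw [s5dMargin, s5dMargin, hp0]
  simp only [decoyList, cshMarg_cons, cshMarg_nil, zero_mul, sub_zero, obsConst, avoidConst, hsymm, List.not_mem_nil, setOf_false,
    union_empty]
  ring

end CSH

end Summit.CriticalPhenomena.PercolationContinuityZ3.Theorems

end
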